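import Mathlib
import Summits.Ventures.HodgeRepro.Tier4.Line4.L1Class

/-!
# Tier4/Line4/ArchApproxBump — C-L4-ARCHAPPROX, part 1: archimedean test factors, the normalised bump on `G_∞`, the
continuity of `convInf`, and the approximation estimate `‖(finf ⋆ e)(x) − finf(x_∞)‖ ≤ ε`

Blind re-derivation cell `pub-hodge-repro`, Tier 4 «prove the step» (README §9–§10), seat t4-L1-p1 (prover, LINE L1,
gen 4; the lead's (R-21) S14968 on crit-1's PRECISION 5, Line4 Entry 108 S14967; statements posted S14990).  Tree path
`lean/Summits/Ventures/HodgeRepro/Tier4/Line4/ArchApproxBump.lean`.  Mathlib-level; no literature.  Part 1 of 3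
(ArchApproxBump → ArchApproxEstimate → ArchApprox), split by the gate's 400-line rule.

WHAT IS PROVED (every declaration sorry-free, axioms `[propext, Classical.choice, Quot.sound]`).
* `IsInfFactor W e` — an archimedean test factor (the twin of L1Class `IsFinFactor`): continuous, a function of the
  archimedean coordinate only, of compact support on `G_∞`.
* `exists_bump_infinitePart` — Urysohn on the locally compact group `G_∞`: a continuous non-negative bump, `1` at `1`,
  vanishing outside a given open neighbourhood of `1`; `integral_bump_inv_pos` / `integral_bump_inv_mul` — the
  normalising integral `∫ b(y⁻¹) dμ_∞` is positive and `∫ b(y⁻¹ z) dμ_∞(y)` does not depend on `z` (left invariance).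
* `infOf x = ⟨x_∞, _⟩ ∈ G_∞` and its calculus (`infOf_coe`, `coe_infOf`, `infOf_inv_mul`).
* `continuous_convInf_of_isInfFactor` — `convInf μ_∞ finf e` (ConvProduct) is continuous for `finf` continuous and
  `e` an archimedean test factor (the integrand has compact support inside a fixed compact for `x_∞` near a point;
  `continuous_parametric_integral_of_continuous`).
* `norm_convInf_sub_le` — THE APPROXIMATION ESTIMATE: for the normalised bump `e = b ∘ infOf` (`∫ b(y⁻¹ z) dy = 1`,
  `b ≥ 0`, `b = 0` outside `U`) and `finf` uniformly `ε`-continuous on `K` along `U`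
  (`‖finf(z u⁻¹) − finf z‖ ≤ ε` for `z ∈ K`, `u ∈ U`): `‖(finf ⋆ e)(x) − finf(x_∞)‖ ≤ ε` whenever `x_∞ ∈ K` —
  `(finf ⋆ e)(x) − finf(x_∞) = ∫ (finf(y) − finf(x_∞)) e(y⁻¹ x_∞) dy`, the integrand supported where `y⁻¹x_∞ ∈ U`.

Nothing here says anything about the status of the Hodge conjecture for CM abelian varieties, which is NOT proved
(HC_CM is NOT proved by anyone in this repository).
-/

set_option autoImplicit false
noncomputable section
namespace Summit.Ventures.HodgeRepro.Tier4.Line4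
open Summit.Ventures.HodgeRepro.Tier4 Summit.Ventures.HodgeRepro.Tier4.Common Summit.Ventures.HodgeRepro.Tier4.Line1
  Summit.Ventures.HodgeRepro.Tier4.Line4.L1Class MeasureTheory NumberField
open scoped ComplexConjugate Topology Pointwise

section ArchApprox

variable {k : Type} [Field k] [NumberField k] (W : PlaneData k) [MeasurableSpace (GA W)] [BorelSpace (GA W)]

omit [MeasurableSpace (GA W)] [BorelSpace (GA W)] in
/-- **an archimedean test factor** (the twin of `IsFinFactor`): continuous, a function of the archimedean coordinate
only, of compact support on `G_∞`. -/
structure IsInfFactor (e : GA W → ℂ) : Prop where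
  cont : Continuous e
  infOnly : ∀ x, e x = e (GA.ofInfPart W x)
  compact : HasCompactSupport (fun x : infinitePart W => e (x : GA W))

/-! ### Helpers for the approximate identity: a normalised bump on `G_∞`, continuity of `convInf`, the two estimates -/

omit [MeasurableSpace (GA W)] [BorelSpace (GA W)] in
/-- a continuous bump on `G_∞`: `1` at `1`, non-negative, compactly supported, vanishing outside a given open
neighbourhood `U` of `1` (Urysohn on the locally compact group `G_∞`). -/
theorem exists_bump_infinitePart {U : Set (infinitePart W)} (hU : IsOpen U) (h1 : (1 : infinitePart W) ∈ U) :
    ∃ b : infinitePart W → ℝ, Continuous b ∧ HasCompactSupport b ∧ (∀ y, 0 ≤ b y) ∧ b 1 = 1 ∧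
      ∀ y, y ∉ U → b y = 0 := by
  haveI := locallyCompact_infinitePart W
  obtain ⟨f, hf1, hf0, hfc, hf01⟩ := exists_continuous_one_zero_of_isCompact (X := infinitePart W)
    (isCompact_singleton (x := (1 : infinitePart W))) hU.isClosed_compl
    (Set.disjoint_singleton_left.2 (fun h => h h1))
  refine ⟨f, f.continuous, hfc, fun y => (hf01 y).1, ?_, fun y hy => ?_⟩
  · simpa using hf1 (Set.mem_singleton (1 : infinitePart W))
  · simpa using hf0 hy

omit [MeasurableSpace (GA W)] [BorelSpace (GA W)] in
/-- `integral_ofReal` for `ℂ`, in the `Complex.ofReal` spelling. -/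
theorem integral_complex_ofReal {X : Type} [MeasurableSpace X] (μ : Measure X) (f : X → ℝ) :
    ∫ x, ((f x : ℝ) : ℂ) ∂μ = ((∫ x, f x ∂μ : ℝ) : ℂ) :=
  integral_ofReal

/-- the normalising integral `∫ b(y⁻¹) dμ_∞(y)` of a non-negative bump with `b 1 = 1` is positive. -/
theorem integral_bump_inv_pos (μinf : Measure (infinitePart W)) [μinf.IsHaarMeasure]
    {b : infinitePart W → ℝ} (hb : Continuous b) (hbc : HasCompactSupport b) (hb0 : ∀ y, 0 ≤ b y)
    (hb1 : b 1 = 1) : 0 < ∫ y, b y⁻¹ ∂μinf := by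
  have hcont : Continuous fun y : infinitePart W => b y⁻¹ := hb.comp continuous_inv
  have hsupp : HasCompactSupport fun y : infinitePart W => b y⁻¹ :=
    hbc.comp_homeomorph (Homeomorph.inv (infinitePart W))
  exact hcont.integral_pos_of_hasCompactSupport_nonneg_nonzero hsupp (fun y => hb0 y⁻¹)
    (x := 1) (by simp [hb1])

/-- the left-translation law of the normalising integral: `∫ b(y⁻¹ z) dμ_∞(y) = ∫ b(y⁻¹) dμ_∞(y)` for every `z`. -/
theorem integral_bump_inv_mul (μinf : Measure (infinitePart W)) [μinf.IsHaarMeasure]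
    (b : infinitePart W → ℝ) (z : infinitePart W) : ∫ y, b (y⁻¹ * z) ∂μinf = ∫ y, b y⁻¹ ∂μinf := by
  haveI := secondCountable_infinitePart W
  have := integral_mul_left_eq_self (μ := μinf) (fun y : infinitePart W => b y⁻¹) z⁻¹
  simpa [mul_inv_rev] using this

/-- the element `⟨x_∞, _⟩` of `G_∞` attached to `x ∈ G(𝔸)`. -/
def infOf (x : GA W) : infinitePart W := ⟨GA.ofInfPart W x, GA.ofInfPart_mem_infinitePart W x⟩

omit [MeasurableSpace (GA W)] [BorelSpace (GA W)] in
/-- `x ↦ ⟨x_∞, _⟩` is continuous (`continuous_ofInfPart`). -/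
theorem continuous_infOf : Continuous (infOf W) := (continuous_ofInfPart W).subtype_mk _

omit [MeasurableSpace (GA W)] [BorelSpace (GA W)] in
/-- `infOf` is the identity on `G_∞`. -/
theorem infOf_coe (y : infinitePart W) : infOf W (y : GA W) = y :=
  Subtype.ext (ofInfPart_eq_self_of_mem_infinitePart W y.2)

omit [MeasurableSpace (GA W)] [BorelSpace (GA W)] in
/-- the underlying element of `infOf x` is `x_∞`. -/
theorem coe_infOf (x : GA W) : (infOf W x : GA W) = GA.ofInfPart W x := rfl

omit [MeasurableSpace (GA W)] [BorelSpace (GA W)] in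
/-- `(y⁻¹ x_∞)_∞ = y⁻¹ · infOf x` for `y ∈ G_∞`. -/
theorem infOf_inv_mul (y : infinitePart W) (x : GA W) :
    infOf W ((y : GA W)⁻¹ * GA.ofInfPart W x) = y⁻¹ * infOf W x := by
  apply Subtype.ext
  simp only [coe_infOf, ofInfPart_mul, ofInfPart_inv, Subgroup.coe_mul, Subgroup.coe_inv,
    ofInfPart_eq_self_of_mem_infinitePart W y.2,
    ofInfPart_eq_self_of_mem_infinitePart W (GA.ofInfPart_mem_infinitePart W x)]

/-- `convInf finf e` is continuous for `finf` continuous and `e` an archimedean test factor (the integrand has compact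
support in `y` inside a fixed compact for `x_∞` in a compact neighbourhood; `continuous_parametric_integral_of_continuous`). -/
theorem continuous_convInf_of_isInfFactor (μinf : Measure (infinitePart W)) [μinf.IsHaarMeasure]
    {finf : GA W → ℂ} (hfinf : Continuous finf) {e : GA W → ℂ} (he : IsInfFactor W e) :
    Continuous (convInf W μinf finf e) := by
  haveI := locallyCompact_infinitePart W
  haveI := secondCountable_infinitePart W
  haveI := t2Space_GA W
  -- the convolution as a function of `z = x_∞ ∈ G_∞`
  let Φ : infinitePart W → ℂ := fun z => ∫ y : infinitePart W, finf y * e ((y : GA W)⁻¹ * z) ∂μinf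
  have hΦ : Continuous Φ := by
    rw [continuous_iff_continuousAt]
    intro z₀
    obtain ⟨V, hVc, hV⟩ := exists_compact_mem_nhds z₀
    -- the support of `y ↦ e (y⁻¹ z)` for `z ∈ V` lies in the compact `s = V * S⁻¹`
    set S : Set (infinitePart W) := tsupport (fun y : infinitePart W => e (y : GA W)) with hS
    have hSc : IsCompact S := he.compact
    set s : Set (infinitePart W) := V * S⁻¹ with hs
    have hsc : IsCompact s := hVc.mul hSc.inv
    have hF : Continuous (Function.uncurry fun (z : infinitePart W) (y : infinitePart W) =>
        finf y * e ((y : GA W)⁻¹ * z)) := by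
      apply Continuous.mul
      · exact hfinf.comp (continuous_subtype_val.comp continuous_snd)
      · exact he.cont.comp (((continuous_subtype_val.comp continuous_snd).inv).mul
          (continuous_subtype_val.comp continuous_fst))
    have hcont : Continuous fun z : infinitePart W =>
        ∫ y in s, finf y * e ((y : GA W)⁻¹ * z) ∂μinf :=
      continuous_parametric_integral_of_continuous hF hsc
    refine hcont.continuousAt.congr (Filter.eventuallyEq_of_mem hV fun z hz => ?_)
    show (∫ y in s, finf y * e ((y : GA W)⁻¹ * z) ∂μinf) = Φ z
    apply setIntegral_eq_integral_of_forall_compl_eq_zero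
    intro y hy
    have hzero : e ((y : GA W)⁻¹ * z) = 0 := by
      by_contra hne
      apply hy
      -- `y⁻¹ z ∈ S`, so `y = z (y⁻¹ z)⁻¹ ∈ V S⁻¹`
      have hmem : (y⁻¹ * z : infinitePart W) ∈ S := by
        apply subset_tsupport
        show e (((y⁻¹ * z : infinitePart W) : GA W)) ≠ 0
        simpa using hne
      refine ⟨z, hz, (y⁻¹ * z)⁻¹, Set.inv_mem_inv.2 hmem, ?_⟩
      simp
    simp [hzero]
  have hcomp : convInf W μinf finf e = Φ ∘ infOf W := by
    funext x
    rfl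
  rw [hcomp]
  exact hΦ.comp (continuous_infOf W)

/-- **the approximation estimate**: for the normalised bump `e = b ∘ infOf` (`∫ b(y⁻¹ z) dy = 1`, `b ≥ 0`, `b = 0`
outside `U`) and `finf` uniformly `ε`-continuous on `K` along `U` (`‖finf(z u⁻¹) − finf z‖ ≤ ε` for `z ∈ K`, `u ∈ U`),
`‖(finf ⋆ e)(x) − finf(x_∞)‖ ≤ ε` whenever `x_∞ ∈ K`. -/
theorem norm_convInf_sub_le (μinf : Measure (infinitePart W)) [μinf.IsHaarMeasure]
    {finf : GA W → ℂ} (hfinf : Continuous finf) {b : infinitePart W → ℝ} (hb : Continuous b)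
    (hbc : HasCompactSupport b) (hb0 : ∀ y, 0 ≤ b y) (hbn : ∫ y, b y⁻¹ ∂μinf = 1)
    {U : Set (infinitePart W)} (hbU : ∀ y, y ∉ U → b y = 0) {K : Set (infinitePart W)} {ε : ℝ}
    (hK : ∀ z ∈ K, ∀ u ∈ U, ‖finf ((z : GA W) * (u : GA W)⁻¹) - finf z‖ ≤ ε)
    (x : GA W) (hx : infOf W x ∈ K) :
    ‖convInf W μinf finf (fun x => ((b (infOf W x) : ℝ) : ℂ)) x - finf (GA.ofInfPart W x)‖ ≤ ε := by
  haveI := secondCountable_infinitePart W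
  haveI := t2Space_GA W
  set z : infinitePart W := infOf W x with hz
  -- the integrand in terms of `z`
  have hrw : ∀ y : infinitePart W,
      ((b (infOf W ((y : GA W)⁻¹ * GA.ofInfPart W x)) : ℝ) : ℂ) = ((b (y⁻¹ * z) : ℝ) : ℂ) := by
    intro y
    rw [infOf_inv_mul]
  have hconv : convInf W μinf finf (fun x => ((b (infOf W x) : ℝ) : ℂ)) x =
      ∫ y : infinitePart W, finf y * ((b (y⁻¹ * z) : ℝ) : ℂ) ∂μinf := by
    unfold convInf
    congr 1
    funext y
    show finf y * ((b (infOf W ((y : GA W)⁻¹ * GA.ofInfPart W x)) : ℝ) : ℂ) = _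
    rw [hrw y]
  -- the bump in `y` has compact support and integral `1`
  have hbz : Continuous fun y : infinitePart W => b (y⁻¹ * z) :=
    hb.comp (continuous_inv.mul continuous_const)
  have hbzc : HasCompactSupport fun y : infinitePart W => b (y⁻¹ * z) :=
    hbc.comp_homeomorph ((Homeomorph.inv (infinitePart W)).trans (Homeomorph.mulRight z))
  have hbzn : ∫ y, b (y⁻¹ * z) ∂μinf = 1 := by rw [integral_bump_inv_mul, hbn]
  have hfz : finf (GA.ofInfPart W x) = ∫ y : infinitePart W, finf z * ((b (y⁻¹ * z) : ℝ) : ℂ) ∂μinf := by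
    rw [integral_const_mul, integral_complex_ofReal, hbzn]
    simp [hz, coe_infOf]
  -- integrability of both integrands
  have hcont₁ : Continuous fun y : infinitePart W => finf y * ((b (y⁻¹ * z) : ℝ) : ℂ) :=
    (hfinf.comp continuous_subtype_val).mul (Complex.continuous_ofReal.comp hbz)
  have hsupp₁ : HasCompactSupport fun y : infinitePart W => finf y * ((b (y⁻¹ * z) : ℝ) : ℂ) :=
    HasCompactSupport.mul_left (hbzc.comp_left Complex.ofReal_zero)
  have hint₁ := hcont₁.integrable_of_hasCompactSupport hsupp₁ (μ := μinf)
  have hcont₂ : Continuous fun y : infinitePart W => finf z * ((b (y⁻¹ * z) : ℝ) : ℂ) :=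
    continuous_const.mul (Complex.continuous_ofReal.comp hbz)
  have hsupp₂ : HasCompactSupport fun y : infinitePart W => finf z * ((b (y⁻¹ * z) : ℝ) : ℂ) :=
    HasCompactSupport.mul_left (hbzc.comp_left Complex.ofReal_zero)
  have hint₂ := hcont₂.integrable_of_hasCompactSupport hsupp₂ (μ := μinf)
  rw [hconv, hfz, ← integral_sub hint₁ hint₂]
  -- the pointwise bound
  have hbound : ∀ y : infinitePart W,
      ‖finf y * ((b (y⁻¹ * z) : ℝ) : ℂ) - finf z * ((b (y⁻¹ * z) : ℝ) : ℂ)‖ ≤ ε * b (y⁻¹ * z) := by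
    intro y
    rw [← sub_mul, norm_mul, Complex.norm_real, Real.norm_of_nonneg (hb0 _)]
    by_cases hyU : y⁻¹ * z ∈ U
    · apply mul_le_mul_of_nonneg_right _ (hb0 _)
      have := hK z hx (y⁻¹ * z) hyU
      have hy : (z : GA W) * ((y⁻¹ * z : infinitePart W) : GA W)⁻¹ = y := by
        simp
      rw [hy] at this
      exact this
    · rw [hbU _ hyU]
      simp
  have hgint : Integrable (fun y : infinitePart W => ε * b (y⁻¹ * z)) μinf :=
    (hbz.integrable_of_hasCompactSupport hbzc).const_mul ε
  calc ‖∫ y, (finf y * ((b (y⁻¹ * z) : ℝ) : ℂ) - finf z * ((b (y⁻¹ * z) : ℝ) : ℂ)) ∂μinf‖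
      ≤ ∫ y, ε * b (y⁻¹ * z) ∂μinf :=
        norm_integral_le_of_norm_le hgint (Filter.Eventually.of_forall hbound)
    _ = ε := by rw [integral_const_mul, hbzn, mul_one]

end ArchApprox

end Summit.Ventures.HodgeRepro.Tier4.Line4

end
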